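import Summits.BirchSwinnertonDyer.BirchSwinnertonDyer.Theorems.EisensteinPrimesResidualDevissageCountNonsplit
import Summits.BirchSwinnertonDyer.BirchSwinnertonDyer.Theorems.EisensteinPrimesKellerYinLemma511OfCharacterResidualFiniteness
import Literature.NumberTheory.EllipticCurves.KellerYin2024.CharacterResidualUnrSelmerFinite
import HarnessLib

/-!
# The residual λ-count at EVERY multiplicative Eisenstein datum (split OR non-split), conditional on the character-level
# preprint clause `KellerYin2024.prop125_residualCharacterUnrSelmer_finite_OPEN`: `p^{λ(X^{Sf})} · #X^{Sf}[p] ≤ #R(S) · #R(E_K[p]/S) ·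
# #((E_K[p]/S)^{G_{K_{∞,v̄}}})^{p^c}`, and the «`≥`» half modulo the residual surjectivity (cell `bsd-eis`, seat `bsd-line-x2-p2`
# gen 5, D-0154 KEY row 5; crux 4 `BSDpOnCellC` line b1; sequel of `…ResidualDevissageCountNonsplit`)

HONEST FRAMING (cell `bsd-eis`, run/shared/lean/pub/bsd-eis/): bookkeeping on constructed objects; no definition, no new named fact,
no `sorry`, no `Theses` import; every theorem is CONDITIONAL on `hprop125` = Keller–Yin arXiv:2402.12781v2 Prop. 1.2.5's finiteness
clause for characters (an unrefereed claim, typed as `KellerYin2024.prop125_residualCharacterUnrSelmer_finite_OPEN`, p629299);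
nothing about BSD or a main conjecture is asserted; nothing booked; no label or count moves. Helper
`--supports stmt-BirchSwinnertonDyer-19034`; closes no stub.

g4's `residualFinite_of_unrCharacterFinite` (p629595) derives, at every datum of Keller–Yin Lemma 5.1.1 (BOTH signs), the finiteness
of the two CHARACTER residual groups `R(S)`, `R(E_K[p]/S)` from the clause and concludes `Sel_v̄^{Sf}(K_∞, E_K[p^∞])[p]` finite
(the `μ`-half). This file stops one step earlier and COUNTS (the `λ`-half, files 1–4):

* §1 `exists_stableSubgroup_residualFinite_of_prop125` — the clause ⟹ for the base-changed rational line `S ≤ E_K[p]`: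
  `#S = #(E_K[p]/S) = p`, good reduction off `Sf ∪ {w ∣ p}`, and `R(S)`, `R(E_K[p]/S)` finite (`Σ = Sf`).
* §2 **`exists_pow_lambdaInvariant_mul_le_of_prop125`** — with (L) at `v̄`: `∃ S c`,
  **`p^{λ(X^{Sf})} · #X^{Sf}[p] ≤ #R(S) · #R(E_K[p]/S) · #((E_K[p]/S)^{ker κ ⊓ D_{v̄}})^{p^c}`** — the «`≤`» half of Keller–Yin
  Thm. 1.4.1's `λ`-clause in residual currency at `p ‖ N` for BOTH signs, with the local error EXPLICIT (it is `1` at a non-split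
  prime, file 4/6; at a split prime it is `≤ p^{p^c}`), conditional on the character-level clause + (L).
* §3 `exists_mul_le_pow_lambdaInvariant_mul_of_prop125_of_surjective` — the «`≥`» half at the same datum:
  `#R(S) · #R(E_K[p]/S) ≤ p^{λ} · #X[p] · #((E_K[p]/S)^{ker κ})` given the residual surjectivity.

References: [KellerYin2024] Prop. 1.2.5, Thm. 1.4.1, Lemma 5.1.1 (arXiv:2402.12781v2); [CastellaGrossiLeeSkinner2022] Props. 14, 17, 18
(arXiv:2008.02571); [GreenbergVatsal2000] §2 Prop. (2.8); [Brink2007] Cor. 1; cell p629299, p629595 (g4), p635607 (this seat).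
-/

set_option autoImplicit false
set_option linter.dupNamespace false -- the summit namespace `…BirchSwinnertonDyer.BirchSwinnertonDyer.Theorems` (Sub = Summit, D-0017) trips it

noncomputable section

open scoped Classical Pointwise

namespace Summit.BirchSwinnertonDyer.BirchSwinnertonDyer.Theorems.ResidualDevissageBothSigns

open WeierstrassCurve NumberField IsDedekindDomain Field
  Literature.NumberTheory.EllipticCurves Literature.NumberTheory.EllipticCurves.IwasawaAlgebra
  Literature.NumberTheory.EllipticCurves.GreenbergSelmer
  Literature.NumberTheory.EllipticCurves.GreenbergVatsal2000
  Literature.NumberTheory.GaloisRepresentations IsDedekindDomain.HeightOneSpectrum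
  Literature.NumberTheory.EllipticCurves.Rank1Residual
  Summit.BirchSwinnertonDyer.Rank1Residual.X11b Summit.BirchSwinnertonDyer.Rank1Residual.X11b.AcSelmer
  Summit.BirchSwinnertonDyer.Rank1Residual.X2.ResidualDevissageModules
  Summit.BirchSwinnertonDyer.BirchSwinnertonDyer.Theorems
  Summit.BirchSwinnertonDyer.BirchSwinnertonDyer.Theorems.ResidualDevissageCountNonsplit
  Summit.BirchSwinnertonDyer.BirchSwinnertonDyer.Theorems.CumulativeHeegnerInclusionAtThreeResidualDevissage
  Summit.BirchSwinnertonDyer.BirchSwinnertonDyer.Theorems.CumulativeHeegnerInclusionAtThreeLineBaseChange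
  Summit.BirchSwinnertonDyer.BirchSwinnertonDyer.Theorems.CumulativeHeegnerInclusionAtThreeBadPlaces
  Summit.BirchSwinnertonDyer.BirchSwinnertonDyer.Theorems.AdditiveKoly.SplitCompletion
  Summit.BirchSwinnertonDyer.BirchSwinnertonDyer.Theorems.KellerYinLemma511OfCharacterResidualFiniteness
open Literature.NumberTheory.EllipticCurves.KellerYin2024 (prop125_residualCharacterUnrSelmer_finite_OPEN)

/-! ### §1 The character clause ⟹ the two residual groups of the line are finite (both signs) -/

/-- **Keller–Yin Prop. 1.2.5's clause ⟹ at every Eisenstein datum over `K` (`2 < p`, `E[p]` reducible, `K` imaginary quadratic Heegner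
for `N_E`, `(p)` split, `v̄ ∋ p`, `κ` anticyclotomic, `Sf` = the places over `N_E` off `p`; ANY reduction type at `p`): the base-changed
rational line `S ≤ E_K[p]` has `#S = #(E_K[p]/S) = p`, `E_K` has good reduction off `Sf ∪ {w ∣ p}`, and `R_v̄^{Sf}(K_∞, S)`,
`R_v̄^{Sf}(K_∞, E_K[p]/S)` are FINITE** (g4's p629595 §2 stopped before the dévissage: the clause for `M = S`, `M = E_K[p]/S`, then
strict ⊆ unramified). CONDITIONAL on the preprint clause. [claim: KellerYin2024, status: under-review]
[cite: KellerYin2024, Prop. 1.2.5 and Lemma 5.1.1 (arXiv:2402.12781v2)] [cite: CastellaGrossiLeeSkinner2022, §1.4 Prop. 17 (arXiv:2008.02571)] -/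
theorem exists_stableSubgroup_residualFinite_of_prop125 (hprop125 : prop125_residualCharacterUnrSelmer_finite_OPEN)
    {p : ℕ} [hp : Fact p.Prime] (W : WeierstrassCurve ℚ) [W.IsElliptic] [W.IsGloballyMinimal]
    (K : Type) [Field K] [NumberField K] (vbar : HeightOneSpectrum (𝓞 K))
    (κ : ZpExtension K p) (Sf : Finset (HeightOneSpectrum (𝓞 K)))
    (hp2 : 2 < p) (hred : Red W p) (hK : IsImaginaryQuadratic K)
    (hH : SatisfiesHeegnerHypothesis (W.conductorNorm ℤ) K)
    (hsplit : ((Ideal.span {(p : ℤ)}).primesOver (𝓞 K)).ncard = 2)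
    (hvbar : ((p : ℕ) : 𝓞 K) ∈ vbar.asIdeal) (hκ : κ.IsAnticyclotomic)
    (hSf : ∀ w : HeightOneSpectrum (𝓞 K), w ∈ Sf ↔
      (((W.conductorNorm ℤ : ℤ) : 𝓞 K) ∈ w.asIdeal ∧ ((p : ℕ) : 𝓞 K) ∉ w.asIdeal)) :
    ∃ S : StableSubgroup (absoluteGaloisGroup K) ((W.baseChange K).geomTorsion ((p : ℕ) : ℤ)),
      Nat.card S.Sub = p ∧ Nat.card S.Quot = p ∧
        (∀ w : HeightOneSpectrum (𝓞 K), w ∉ (↑Sf : Set (HeightOneSpectrum (𝓞 K))) → ((p : ℕ) : 𝓞 K) ∉ w.asIdeal →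
          (W.baseChange K).HasGoodReductionAt w) ∧
        (datumStrictSelmer κ.kerSubgroup S.Sub p (AcSelmer.bdpData S.Sub p vbar) (↑Sf : Set (HeightOneSpectrum (𝓞 K))) :
          Set (subgroupH1 κ.kerSubgroup S.Sub)).Finite ∧
        (datumStrictSelmer κ.kerSubgroup S.Quot p (AcSelmer.bdpData S.Quot p vbar) (↑Sf : Set (HeightOneSpectrum (𝓞 K))) :
          Set (subgroupH1 κ.kerSubgroup S.Quot)).Finite := by
  have hpp : p.Prime := hp.out
  have hp2' : p ≠ 2 := by omega
  haveI hEK : (W.baseChange K).IsElliptic := inferInstanceAs (W.map (algebraMap ℚ K)).IsElliptic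
  obtain ⟨Φ, hΦ⟩ := exists_isRationalLine_of_not_irr W p hred
  obtain ⟨t, ht⟩ := exists_geomTorsion_baseChange_equiv W K ((p : ℕ) : ℤ)
  have ht' : ∀ (σ : absoluteGaloisGroup K) (P : W.geomTorsion ((p : ℕ) : ℤ)),
      t (absGaloisRestrict ℚ K σ • P) = σ • t P := fun σ P ↦ by
    rw [← resGal_eq_absGaloisRestrict]; exact ht σ P
  obtain ⟨S, -, hcardS⟩ := exists_stableSubgroup_corr Φ t ht' hΦ.2
  have hSub : Nat.card S.Sub = p := by rw [hcardS, hΦ.1]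
  have hEp : Nat.card ((W.baseChange K).geomTorsion ((p : ℕ) : ℤ)) = p ^ 2 :=
    (W.baseChange K).natCard_geomTorsion_prime_eq_sq hpp
  have hQuot : Nat.card S.Quot = p := by
    have h := S.natCard_eq_mul
    rw [hEp, hSub, sq] at h
    exact (Nat.eq_of_mul_eq_mul_right hpp.pos h).symm
  set S₀ : Set (HeightOneSpectrum (𝓞 K)) := (↑Sf : Set (HeightOneSpectrum (𝓞 K))) with hS₀
  have hS₀fin : S₀.Finite := Sf.finite_toSet
  have hgood : ∀ w : HeightOneSpectrum (𝓞 K), w ∉ S₀ → ((p : ℕ) : 𝓞 K) ∉ w.asIdeal →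
      (W.baseChange K).HasGoodReductionAt w := fun w hw hpw ↦ by
    by_contra hbad
    obtain ⟨ℓ, -, hℓw, hℓN⟩ := exists_prime_mem_dvd_conductorNorm_of_not_hasGoodReductionAt W K w hbad
    apply hw
    rw [hS₀, Finset.mem_coe, hSf]
    refine ⟨?_, hpw⟩
    obtain ⟨m, hm⟩ := hℓN
    rw [hm, Nat.cast_mul, Int.cast_mul, Int.cast_natCast]
    exact w.asIdeal.mul_mem_right _ hℓw
  have hS₀mem : ∀ w ∈ S₀, ((p : ℕ) : 𝓞 K) ∉ w.asIdeal ∧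
      ((w.asIdeal.under ℤ).primesOver (𝓞 K)).ncard = 2 := fun w hw ↦ by
    rw [hS₀, Finset.mem_coe, hSf] at hw
    refine ⟨hw.2, ?_⟩
    obtain ⟨ℓ, hℓ, hℓw⟩ := exists_prime_natCast_mem_asIdeal w
    haveI : Fact ℓ.Prime := ⟨hℓ⟩
    have hunder : w.asIdeal.under ℤ = Ideal.span {(ℓ : ℤ)} :=
      (liesOver_span_int K ℓ w (by exact_mod_cast hℓw)).over.symm
    have hℓN : ℓ ∣ W.conductorNorm ℤ := by
      have hmem : ((W.conductorNorm ℤ : ℕ) : ℤ) ∈ w.asIdeal.under ℤ := by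
        rw [Ideal.under_def, Ideal.mem_comap, map_natCast]
        have := hw.1
        rwa [Int.cast_natCast] at this
      rw [hunder, Ideal.mem_span_singleton] at hmem
      exact_mod_cast hmem
    rw [hunder]
    exact hH ℓ hℓ hℓN
  have hM : ∀ m : (W.baseChange K).geomTorsion ((p : ℕ) : ℤ),
      Continuous fun g : absoluteGaloisGroup K ↦ g • m :=
    continuous_smul_geomTorsion (W.baseChange K) ((p : ℕ) : ℤ)
  have hunrE : ∀ w : HeightOneSpectrum (𝓞 K), w ∉ S₀ → ((p : ℕ) : 𝓞 K) ∉ w.asIdeal →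
      ∀ x ∈ inertia w, ∀ m : (W.baseChange K).geomTorsion ((p : ℕ) : ℤ), x • m = m :=
    fun w hw hpw x hx m ↦ smul_geomTorsion_eq_of_mem_inertia_chosen (W.baseChange K) (hgood w hw hpw) hpw hx m
  have hunrSub : ∀ w : HeightOneSpectrum (𝓞 K), w ∉ S₀ → ((p : ℕ) : 𝓞 K) ∉ w.asIdeal →
      ∀ x ∈ inertia w, ∀ m : S.Sub, x • m = m := fun w hw hpw x hx m ↦
    S.incl_injective (by rw [StableSubgroup.incl_smul]; exact hunrE w hw hpw x hx _)
  have hunrQuot : ∀ w : HeightOneSpectrum (𝓞 K), w ∉ S₀ → ((p : ℕ) : 𝓞 K) ∉ w.asIdeal →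
      ∀ x ∈ inertia w, ∀ m : S.Quot, x • m = m := fun w hw hpw x hx m ↦ by
    obtain ⟨n, rfl⟩ := S.proj_surjective m
    rw [StableSubgroup.smul_proj, hunrE w hw hpw x hx]
  refine ⟨S, hSub, hQuot, hgood, ?_, ?_⟩
  · exact strictResidual_finite_of_unrResidual_finite κ vbar S₀ S.Sub
      (hprop125 K p hK hp2' hsplit κ hκ vbar hvbar S.Sub hSub (S.continuous_smul_sub hM) S₀ hS₀fin hS₀mem hunrSub)
  · exact strictResidual_finite_of_unrResidual_finite κ vbar S₀ S.Quot
      (hprop125 K p hK hp2' hsplit κ hκ vbar hvbar S.Quot hQuot (S.continuous_smul_quot hM) S₀ hS₀fin hS₀mem hunrQuot)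

/-! ### §2 The «≤» half for BOTH signs, local error explicit -/

/-- **`∃ S c`: `p^{λ(X^{Sf})} · #X^{Sf}[p] ≤ #R(S) · #R(E_K[p]/S) · #((E_K[p]/S)^{ker κ ⊓ D_{v̄}})^{p^c}` at every Eisenstein datum
over `K` — split OR non-split, indeed any reduction type at `p`** (`X^{Sf} = AcSelmer.XAc (E_K) p κ v̄ ↑Sf γ`; `p^c` = the number
of representatives Brink's finite decomposition of `v̄` in `K_∞` provides). Hypotheses beyond the datum: the character clause
`hprop125` and (L) «`E_K[p^∞]^{ker κ ⊓ D_{v̄}}` has no `p`-torsion» (free at a non-split prime, file 7). The last factor is `1`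
whenever `E_K[p]/S` has no `ker κ ⊓ D_{v̄}`-fixed vector (non-split prime; non-anomalous good prime) and `≤ p^{p^c}` always.
[claim: KellerYin2024, status: under-review] [cite: KellerYin2024, Prop. 1.2.5, Thm. 1.4.1 (arXiv:2402.12781v2)]
[cite: GreenbergVatsal2000, §2 Prop. (2.8)] [cite: Brink2007, Cor. 1] -/
theorem exists_pow_lambdaInvariant_mul_le_of_prop125 (hprop125 : prop125_residualCharacterUnrSelmer_finite_OPEN)
    {p : ℕ} [hp : Fact p.Prime] (W : WeierstrassCurve ℚ) [W.IsElliptic] [W.IsGloballyMinimal]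
    (K : Type) [Field K] [NumberField K] (vbar : HeightOneSpectrum (𝓞 K))
    (κ : ZpExtension K p) (γ : absoluteGaloisGroup K) [Fact (κ.IsTopGenerator γ)] (Sf : Finset (HeightOneSpectrum (𝓞 K)))
    (hp2 : 2 < p) (hred : Red W p) (hK : IsImaginaryQuadratic K)
    (hH : SatisfiesHeegnerHypothesis (W.conductorNorm ℤ) K)
    (hsplit : ((Ideal.span {(p : ℤ)}).primesOver (𝓞 K)).ncard = 2)
    (hvbar : ((p : ℕ) : 𝓞 K) ∈ vbar.asIdeal) (hκ : κ.IsAnticyclotomic)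
    (hSf : ∀ w : HeightOneSpectrum (𝓞 K), w ∈ Sf ↔
      (((W.conductorNorm ℤ : ℤ) : 𝓞 K) ∈ w.asIdeal ∧ ((p : ℕ) : 𝓞 K) ∉ w.asIdeal))
    (hL : ∀ m : (W.baseChange K).geomPrimaryTorsion p,
      (∀ σ ∈ κ.kerSubgroup ⊓ decomp vbar, σ • m = m) → p • m = 0 → m = 0) :
    ∃ (S : StableSubgroup (absoluteGaloisGroup K) ((W.baseChange K).geomTorsion ((p : ℕ) : ℤ))) (c : ℕ),
      Nat.card S.Sub = p ∧ Nat.card S.Quot = p ∧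
        p ^ lambdaInvariant p (XAc (W.baseChange K) p κ vbar (↑Sf : Set (HeightOneSpectrum (𝓞 K))) γ) *
            Nat.card {x : XAc (W.baseChange K) p κ vbar (↑Sf : Set (HeightOneSpectrum (𝓞 K))) γ // p • x = 0} ≤
          Nat.card (datumStrictSelmer κ.kerSubgroup S.Sub p (AcSelmer.bdpData S.Sub p vbar)
              (↑Sf : Set (HeightOneSpectrum (𝓞 K)))) *
            Nat.card (datumStrictSelmer κ.kerSubgroup S.Quot p (AcSelmer.bdpData S.Quot p vbar)
              (↑Sf : Set (HeightOneSpectrum (𝓞 K)))) *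
            Nat.card {y : S.Quot // ∀ g : ↥(κ.kerSubgroup ⊓ decomp vbar), g • y = y} ^ (p ^ c) := by
  have hp2' : p ≠ 2 := by omega
  haveI hEK : (W.baseChange K).IsElliptic := inferInstanceAs (W.map (algebraMap ℚ K)).IsElliptic
  obtain ⟨S, hSub, hQuot, hgood, hΦ, hΨ⟩ := exists_stableSubgroup_residualFinite_of_prop125 hprop125 W K vbar κ Sf hp2 hred
    hK hH hsplit hvbar hκ hSf
  have h𝔭dec : ¬ (decomp vbar ≤ κ.kerSubgroup) :=
    ZpExtension.decomp_not_le_kerSubgroup_above_of_isAnticyclotomic_holds K p hK hp2' κ hκ vbar hvbar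
  obtain ⟨c, hc⟩ := UniversalToricDescentResidualSelmerFinite.forall_resOfLe_conjH1_eq_zero_of_reps (M := S.Sub)
    (κ := κ) vbar h𝔭dec
  have hτex : ∀ i : ℕ, ∃ τ : absoluteGaloisGroup K, κ τ = Multiplicative.ofAdd ((i : ℕ) : ℤ_[p]) :=
    fun i ↦ κ.surjective _
  choose τ hτ using hτex
  exact ⟨S, c, hSub, hQuot, pow_lambdaInvariant_le_of_stableSubgroup_fixed (W.baseChange K) κ γ hp2' hvbar h𝔭dec
    Sf.finite_toSet hgood hL S c τ (hc τ hτ) hΦ hΨ⟩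

/-! ### §3 The «≥» half at the same datum, modulo the residual surjectivity -/

/-- **`#R(S) · #R(E_K[p]/S) ≤ p^{λ(X^{Sf})} · #X^{Sf}[p] · #((E_K[p]/S)^{ker κ})` at every Eisenstein datum over `K` (both signs),
GIVEN the residual surjectivity `R(E_K[p]) ↠ R(E_K[p]/S)`** for the `S` of §1 (the clause makes `R(E_K[p])` finite through g4's
dévissage and the Kummer comparison). The last factor is Keller–Yin's `+1` (`= p` iff the quotient character is trivial on `G_{K_∞}`).
[claim: KellerYin2024, status: under-review] [cite: KellerYin2024, Thm. 1.4.1, Rem. 1.4.2 (arXiv:2402.12781v2)]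
[cite: PollackWeston2011, App. A Prop. A.2] -/
theorem exists_mul_le_pow_lambdaInvariant_mul_of_prop125_of_surjective
    (hprop125 : prop125_residualCharacterUnrSelmer_finite_OPEN)
    {p : ℕ} [hp : Fact p.Prime] (W : WeierstrassCurve ℚ) [W.IsElliptic] [W.IsGloballyMinimal]
    (K : Type) [Field K] [NumberField K] (vbar : HeightOneSpectrum (𝓞 K))
    (κ : ZpExtension K p) (γ : absoluteGaloisGroup K) [Fact (κ.IsTopGenerator γ)] (Sf : Finset (HeightOneSpectrum (𝓞 K)))
    (hp2 : 2 < p) (hred : Red W p) (hK : IsImaginaryQuadratic K)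
    (hH : SatisfiesHeegnerHypothesis (W.conductorNorm ℤ) K)
    (hsplit : ((Ideal.span {(p : ℤ)}).primesOver (𝓞 K)).ncard = 2)
    (hvbar : ((p : ℕ) : 𝓞 K) ∈ vbar.asIdeal) (hκ : κ.IsAnticyclotomic)
    (hSf : ∀ w : HeightOneSpectrum (𝓞 K), w ∈ Sf ↔
      (((W.conductorNorm ℤ : ℤ) : 𝓞 K) ∈ w.asIdeal ∧ ((p : ℕ) : 𝓞 K) ∉ w.asIdeal))
    (hL : ∀ m : (W.baseChange K).geomPrimaryTorsion p,
      (∀ σ ∈ κ.kerSubgroup ⊓ decomp vbar, σ • m = m) → p • m = 0 → m = 0) :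
    ∃ S : StableSubgroup (absoluteGaloisGroup K) ((W.baseChange K).geomTorsion ((p : ℕ) : ℤ)),
      Nat.card S.Sub = p ∧ Nat.card S.Quot = p ∧
        ((∀ z ∈ datumStrictSelmer κ.kerSubgroup S.Quot p (AcSelmer.bdpData S.Quot p vbar)
              (↑Sf : Set (HeightOneSpectrum (𝓞 K))),
            ∃ y ∈ datumStrictSelmer κ.kerSubgroup ((W.baseChange K).geomTorsion ((p : ℕ) : ℤ)) p
              (AcSelmer.bdpData _ p vbar) (↑Sf : Set (HeightOneSpectrum (𝓞 K))),
              resH1Hom (ContinuousMonoidHom.id κ.kerSubgroup) S.proj (fun _ b ↦ S.proj_smul _ b) y = z) →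
          Nat.card (datumStrictSelmer κ.kerSubgroup S.Sub p (AcSelmer.bdpData S.Sub p vbar)
                (↑Sf : Set (HeightOneSpectrum (𝓞 K)))) *
              Nat.card (datumStrictSelmer κ.kerSubgroup S.Quot p (AcSelmer.bdpData S.Quot p vbar)
                (↑Sf : Set (HeightOneSpectrum (𝓞 K)))) ≤
            p ^ lambdaInvariant p (XAc (W.baseChange K) p κ vbar (↑Sf : Set (HeightOneSpectrum (𝓞 K))) γ) *
              Nat.card {x : XAc (W.baseChange K) p κ vbar (↑Sf : Set (HeightOneSpectrum (𝓞 K))) γ // p • x = 0} *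
              Nat.card {y : S.Quot // ∀ g : ↥κ.kerSubgroup, g • y = y}) := by
  have hp2' : p ≠ 2 := by omega
  haveI hEK : (W.baseChange K).IsElliptic := inferInstanceAs (W.map (algebraMap ℚ K)).IsElliptic
  obtain ⟨S, hSub, hQuot, hgood, hΦ, hΨ⟩ := exists_stableSubgroup_residualFinite_of_prop125 hprop125 W K vbar κ Sf hp2 hred
    hK hH hsplit hvbar hκ hSf
  have h𝔭dec : ¬ (decomp vbar ≤ κ.kerSubgroup) :=
    ZpExtension.decomp_not_le_kerSubgroup_above_of_isAnticyclotomic_holds K p hK hp2' κ hκ vbar hvbar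
  refine ⟨S, hSub, hQuot, fun hsurjR ↦ ?_⟩
  have hfin := ResidualDevissageFiniteKernel.finite_selmerAc_pTorsion_of_line_devissage_of_finite (W.baseChange K) κ hvbar
    h𝔭dec hgood S hΦ hΨ
  have h2 := UniversalToricDescentResidualSelmerExact.natCard_residualSelmer_eq_natCard_selmerAc_pTorsion (W.baseChange K)
    κ hp2' hvbar hgood hL
  haveI : Finite {s : selmerAc (W.baseChange K) p κ vbar (↑Sf : Set (HeightOneSpectrum (𝓞 K))) // p • s = 0} :=
    hfin.to_subtype
  haveI : Nonempty {s : selmerAc (W.baseChange K) p κ vbar (↑Sf : Set (HeightOneSpectrum (𝓞 K))) // p • s = 0} :=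
    ⟨⟨0, smul_zero _⟩⟩
  have hE : (datumStrictSelmer κ.kerSubgroup ((W.baseChange K).geomTorsion (p : ℤ)) p (AcSelmer.bdpData _ p vbar)
      (↑Sf : Set (HeightOneSpectrum (𝓞 K))) :
      Set (subgroupH1 κ.kerSubgroup ((W.baseChange K).geomTorsion (p : ℤ)))).Finite := by
    refine Set.finite_coe_iff.mp (Nat.finite_of_card_ne_zero ?_)
    change Nat.card (datumStrictSelmer κ.kerSubgroup ((W.baseChange K).geomTorsion (p : ℤ)) p
      (AcSelmer.bdpData _ p vbar) (↑Sf : Set (HeightOneSpectrum (𝓞 K)))) ≠ 0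
    rw [h2]
    exact (Nat.card_pos (α := {s : selmerAc (W.baseChange K) p κ vbar (↑Sf : Set (HeightOneSpectrum (𝓞 K))) //
      p • s = 0})).ne'
  exact mul_natCard_le_pow_lambdaInvariant_mul_of_surjective_fixed (W.baseChange K) κ γ hp2' hvbar Sf.finite_toSet hgood hL
    S hE hsurjR

end Summit.BirchSwinnertonDyer.BirchSwinnertonDyer.Theorems.ResidualDevissageBothSigns

end
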